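import Literature.InformationTheory.Entanglement.TwoRebitSeparabilityProbabilityPolar
import HarnessLib

/-!
# Two-rebit separability probability on a fibre: the eigenvalue integrals (Corollary 2 in coordinates)

Fourth step of the proof of Lovas–Andai 2017, Theorems 1–2 on the fibre over `D = 𝟙`. In the
eigenvalue coordinates `x = m + r`, `y = m − r` (`r > 0`) of the symmetric block, the slices over
the diagonal block `diag(x, y)` are known (`volume_rebitSlice_diag`, `volume_rebitPPTSlice_diag`):
empty unless `0 ≤ y ≤ x ≤ 1`, and for `0 < y < x < 1` equal to `x y (1−x)(1−y) · λ₄(𝔹)`, resp.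
`x y (1−x)(1−y) · χ(ε)`, `χ(ε) = λ₄(rebitDefectBall ε)`, `ε = √(x(1−y)) / √(y(1−x))`. Off the two
boundary values `r ∈ {m, 1 − m}` (a null set for each `m`) this evaluates the integrands of
`volume_rebitFibreBody_one_polar` / `volume_rebitFibrePPTBody_one_polar`, giving Lovas–Andai's
Theorem 1 and Corollary 2 for `𝕂 = ℝ` in these coordinates:

* `volume_rebitFibreBody_one_eigen` :
  `λ₇(D_ℝ(𝟙)) = 4π · λ₄(𝔹) · ∫⁻ m, ∫⁻_{0 < r < min(m, 1−m)} r·w`, `w = xy(1−x)(1−y)`;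
* `volume_rebitFibrePPTBody_one_eigen` :
  `λ₇(P_ℝ(𝟙)) = 4π · ∫⁻ m, ∫⁻_{0 < r < min(m, 1−m)} r·w·χ(ε)`;
* `LovasAndai2017_rebit_fibre_2964_iff_eigen` : the fibre fact is equivalent to
  `64 · ∫∫ r w χ(ε) = 29 · λ₄(𝔹) · ∫∫ r w` — Corollary 2's
  `𝒫_sep(ℝ) = ∫ χ̃₁ dμ₃ = (∫∫ χ̃₁(…)(1−x²)(1−y²)(x−y) dy dx) / (∫∫ (1−x²)(1−y²)(x−y) dy dx)`
  (there with `x, y ∈ (−1, 1)`, here with `x, y ∈ (0, 1)`; `χ̃₁ = χ₁/χ₁(1)`, `χ₁(1) = λ₄(𝔹)`)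
  set equal to `29/64`.

## Not here

`λ₄(𝔹) = 2π²/3` (Lovas–Andai Table 2), the closed form of `χ` (Lemma 6) and the evaluation of the
two integrals (`16/35`-normalisation and `= 29/64`, proof of Theorem 2).

## References

* [LovasAndai2017] A. Lovas, A. Andai, Invariance of separability probability over reduced states
  in 4 × 4 bipartite systems, J. Phys. A 50 (2017) 295303, Theorem 1, Corollary 2 (eq. (psep)),
  Theorem 2 (first display of the proof).
-/

noncomputable section

open MeasureTheory Set Real
open scoped ENNReal Matrix

namespace Literature.InformationTheory.Entanglement

/-! ### The weight, the singular-value ratio and the integration region in `(m, r)` -/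

/-- The weight `r · x y (1 − x)(1 − y)`, `x = m + r`, `y = m − r`: the Jacobian `det(D₁D₂)^d`
(`d = 1`, `D₁ = diag(x, y)`, `D₂ = 𝟙 − D₁`) times the Vandermonde factor `(x − y)/2 = r` of the
eigenvalue coordinates. [cite: LovasAndai2017, Theorem 1 (proof) and Theorem 2 (proof, the weight (1−x²)(1−y²)(x−y))] -/
def rebitEigenWeight (m r : ℝ) : ℝ :=
  r * ((m + r) * (m - r) * (1 - (m + r)) * (1 - (m - r)))

/-- The singular-value ratio `ε = √(x(1−y)) / √(y(1−x))` of `V = D₂^{1/2} D₁^{-1/2}`,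
`D₁ = diag(x, y)`, `D₂ = 𝟙 − D₁`, `x = m + r`, `y = m − r` (the argument of `χ₁`; `χ₁` is
reciprocal-symmetric). [cite: LovasAndai2017, Theorem 1 (proof, σ(V)) and Definition 1] -/
def rebitEigenEps (m r : ℝ) : ℝ :=
  Real.sqrt (m + r) * Real.sqrt (1 - (m - r)) / (Real.sqrt (m - r) * Real.sqrt (1 - (m + r)))

/-- For fixed centre `m`, the admissible half-gaps `r`: `0 < y = m − r` and `x = m + r < 1`, i.e.
`r < min(m, 1 − m)` (positivity of `r` is carried by the integration domain `(0, ∞)`).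
[cite: LovasAndai2017, Theorem 2 (proof, the domain −1 < y < x < 1)] -/
def rebitEigenSet (m : ℝ) : Set ℝ :=
  {r | r < m ∧ r < 1 - m}

/-- `rebitEigenSet m = (−∞, min(m, 1 − m))` is measurable. [folklore] -/
theorem measurableSet_rebitEigenSet (m : ℝ) : MeasurableSet (rebitEigenSet m) := by
  have h : rebitEigenSet m = Iio (min m (1 - m)) := by
    ext r
    simp [rebitEigenSet]
  rw [h]
  exact measurableSet_Iio

/-- The weight is continuous in `r`. [folklore] -/
theorem continuous_rebitEigenWeight (m : ℝ) : Continuous fun r => rebitEigenWeight m r := by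
  unfold rebitEigenWeight
  fun_prop

/-! ### Evaluation of the polar integrands off the null set `{m, 1 − m}` -/

/-- **The state slice in eigenvalue coordinates**: for `r > 0`, `r ∉ {m, 1 − m}`,
`r · λ₄(S(m + r, m − r, 0)) = 𝟙[r < min(m, 1−m)] · r x y (1−x)(1−y) · λ₄(𝔹)`.
[cite: LovasAndai2017, Theorem 1 (proof) and Corollary 2 (proof)] -/
theorem ofReal_mul_volume_rebitSlice_eigen {m r : ℝ} (hr : 0 < r) (h1 : r ≠ m)
    (h2 : r ≠ 1 - m) :
    ENNReal.ofReal r * volume (rebitSlice ![m + r, m - r, 0]) =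
      (rebitEigenSet m).indicator
        (fun r => ENNReal.ofReal (rebitEigenWeight m r) * volume rebitOpBall) r := by
  by_cases hmem : r ∈ rebitEigenSet m
  · rw [indicator_of_mem hmem]
    have hx0 : 0 < m + r := by have := hmem.1; linarith
    have hx1 : m + r < 1 := by have := hmem.2; linarith
    have hy0 : 0 < m - r := by have := hmem.1; linarith
    have hy1 : m - r < 1 := by have := hmem.2; linarith
    rw [volume_rebitSlice_diag hx0 hx1 hy0 hy1, ← mul_assoc, ← ENNReal.ofReal_mul hr.le]
    rfl
  · rw [indicator_of_notMem hmem]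
    simp only [rebitEigenSet, mem_setOf_eq, not_and_or, not_lt] at hmem
    rcases hmem with hm | hm
    · have hlt : m - r < 0 := by
        rcases lt_or_eq_of_le hm with h | h
        · linarith
        · exact absurd h.symm h1
      rw [rebitSlice_eq_empty_of_snd_neg (a := ![m + r, m - r, 0]) (by simpa using hlt),
        measure_empty, mul_zero]
    · have hlt : 1 < m + r := by
        rcases lt_or_eq_of_le hm with h | h
        · linarith
        · exact absurd h.symm h2
      rw [rebitSlice_eq_empty_of_one_lt_fst (a := ![m + r, m - r, 0]) (by simpa using hlt),
        measure_empty, mul_zero]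

/-- **The PPT slice in eigenvalue coordinates**: for `r > 0`, `r ∉ {m, 1 − m}`,
`r · λ₄(S^Γ(m + r, m − r, 0)) = 𝟙[r < min(m, 1−m)] · r x y (1−x)(1−y) · χ(ε(m, r))`.
[cite: LovasAndai2017, Theorem 1 (proof)] -/
theorem ofReal_mul_volume_rebitPPTSlice_eigen {m r : ℝ} (hr : 0 < r) (h1 : r ≠ m)
    (h2 : r ≠ 1 - m) :
    ENNReal.ofReal r * volume (rebitPPTSlice ![m + r, m - r, 0]) =
      (rebitEigenSet m).indicator
        (fun r => ENNReal.ofReal (rebitEigenWeight m r) *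
          volume (rebitDefectBall (rebitEigenEps m r))) r := by
  by_cases hmem : r ∈ rebitEigenSet m
  · rw [indicator_of_mem hmem]
    have hx0 : 0 < m + r := by have := hmem.1; linarith
    have hx1 : m + r < 1 := by have := hmem.2; linarith
    have hy0 : 0 < m - r := by have := hmem.1; linarith
    have hy1 : m - r < 1 := by have := hmem.2; linarith
    rw [volume_rebitPPTSlice_diag hx0 hx1 hy0 hy1, ← mul_assoc, ← ENNReal.ofReal_mul hr.le]
    rfl
  · rw [indicator_of_notMem hmem]
    simp only [rebitEigenSet, mem_setOf_eq, not_and_or, not_lt] at hmem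
    have hsub := rebitPPTSlice_subset ![m + r, m - r, 0]
    rcases hmem with hm | hm
    · have hlt : m - r < 0 := by
        rcases lt_or_eq_of_le hm with h | h
        · linarith
        · exact absurd h.symm h1
      rw [rebitSlice_eq_empty_of_snd_neg (a := ![m + r, m - r, 0]) (by simpa using hlt),
        subset_empty_iff] at hsub
      rw [hsub, measure_empty, mul_zero]
    · have hlt : 1 < m + r := by
        rcases lt_or_eq_of_le hm with h | h
        · linarith
        · exact absurd h.symm h2
      rw [rebitSlice_eq_empty_of_one_lt_fst (a := ![m + r, m - r, 0]) (by simpa using hlt),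
        subset_empty_iff] at hsub
      rw [hsub, measure_empty, mul_zero]

/-- The exceptional set `{m, 1 − m}` is null, so the evaluations hold almost everywhere on
`(0, ∞)`. [folklore] -/
theorem ae_restrict_Ioi_ne_ne (m : ℝ) :
    ∀ᵐ r ∂(volume.restrict (Ioi (0 : ℝ))), 0 < r ∧ r ≠ m ∧ r ≠ 1 - m := by
  rw [ae_restrict_iff' measurableSet_Ioi]
  have hfin : ({m, 1 - m} : Set ℝ).Finite := (finite_singleton _).insert _
  have hnull : volume ({m, 1 - m} : Set ℝ) = 0 := hfin.measure_zero volume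
  filter_upwards [measure_eq_zero_iff_ae_notMem.1 hnull] with r hr hpos
  simp only [mem_insert_iff, mem_singleton_iff, not_or] at hr
  exact ⟨hpos, hr.1, hr.2⟩

/-! ### The unit ball is bounded -/

/-- Every entry of a matrix in the operator-norm unit ball lies in `[−1, 1]` (the diagonal of
`𝟙 − KᵀK ≽ 0` gives `k00² + k10² ≤ 1`, `k01² + k11² ≤ 1`). [folklore] -/
theorem rebitOpBall_subset_Icc : rebitOpBall ⊆ Icc (-1 : Fin 4 → ℝ) 1 := by
  intro k hk
  have h0 : 0 ≤ (1 - (matZ k)ᵀ * matZ k) 0 0 := hk.diag_nonneg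
  have h1 : 0 ≤ (1 - (matZ k)ᵀ * matZ k) 1 1 := hk.diag_nonneg
  simp [matZ, Matrix.mul_apply, Fin.sum_univ_two] at h0 h1
  simp only [mem_Icc]
  constructor
  · intro i
    fin_cases i <;> simp <;> nlinarith [sq_nonneg (k 0 - 1), sq_nonneg (k 1 - 1),
      sq_nonneg (k 2 - 1), sq_nonneg (k 3 - 1), sq_nonneg (k 0 + 1), sq_nonneg (k 1 + 1),
      sq_nonneg (k 2 + 1), sq_nonneg (k 3 + 1)]
  · intro i
    fin_cases i <;> simp <;> nlinarith [sq_nonneg (k 0 - 1), sq_nonneg (k 1 - 1),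
      sq_nonneg (k 2 - 1), sq_nonneg (k 3 - 1), sq_nonneg (k 0 + 1), sq_nonneg (k 1 + 1),
      sq_nonneg (k 2 + 1), sq_nonneg (k 3 + 1)]

/-- `λ₄(𝔹) < ∞`. [folklore] -/
theorem volume_rebitOpBall_lt_top : volume rebitOpBall < ⊤ :=
  ((Metric.isBounded_Icc (-1 : Fin 4 → ℝ) 1).subset rebitOpBall_subset_Icc).measure_lt_top

/-- `λ₄(rebitDefectBall ε) < ∞`. [folklore] -/
theorem volume_rebitDefectBall_lt_top (ε : ℝ) : volume (rebitDefectBall ε) < ⊤ :=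
  lt_of_le_of_lt (measure_mono (rebitDefectBall_subset ε)) volume_rebitOpBall_lt_top

/-! ### Theorem 1 and Corollary 2 in eigenvalue coordinates -/

/-- **Lovas–Andai Theorem 1 / Corollary 2 (denominator), real case, fibre over `𝟙`**:
`λ₇(D_ℝ(𝟙)) = 4π · λ₄(𝔹) · ∫⁻ m, ∫⁻_{r ∈ (0,∞), r < min(m,1−m)} r·x y(1−x)(1−y)`
(Lovas–Andai: `Vol(D_{4,𝕂}(D)) = χ_d(1) · det(D)^{4d−d²/2} 2^{−6d} ∫_E det(I − Y²)^d dY`).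
[cite: LovasAndai2017, Theorem 1 and Corollary 2 (proof: the volume of the whole space)] -/
theorem volume_rebitFibreBody_one_eigen :
    volume (rebitFibreBody (1 : Matrix (Fin 2) (Fin 2) ℝ)) =
      ENNReal.ofReal (4 * π) * (volume rebitOpBall *
        ∫⁻ m : ℝ, ∫⁻ r in Ioi (0 : ℝ),
          (rebitEigenSet m).indicator (fun r => ENNReal.ofReal (rebitEigenWeight m r)) r) := by
  rw [volume_rebitFibreBody_one_polar]
  congr 1
  have hin : ∀ m : ℝ,
      ∫⁻ r in Ioi (0 : ℝ), ENNReal.ofReal r * volume (rebitSlice ![m + r, m - r, 0]) =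
      volume rebitOpBall *
        ∫⁻ r in Ioi (0 : ℝ), (rebitEigenSet m).indicator
          (fun r => ENNReal.ofReal (rebitEigenWeight m r)) r := by
    intro m
    rw [← lintegral_const_mul' _ _ volume_rebitOpBall_lt_top.ne]
    refine lintegral_congr_ae ?_
    filter_upwards [ae_restrict_Ioi_ne_ne m] with r hr
    rw [ofReal_mul_volume_rebitSlice_eigen hr.1 hr.2.1 hr.2.2]
    by_cases h : r ∈ rebitEigenSet m
    · simp only [indicator_of_mem h, mul_comm]
    · simp only [indicator_of_notMem h, mul_zero]
  simp_rw [hin]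
  rw [lintegral_const_mul' _ _ volume_rebitOpBall_lt_top.ne]

/-- **Lovas–Andai Theorem 1 (numerator), real case, fibre over `𝟙`**:
`λ₇(P_ℝ(𝟙)) = 4π · ∫⁻ m, ∫⁻_{r ∈ (0,∞), r < min(m,1−m)} r·x y(1−x)(1−y) · χ(ε(m, r))`
(Lovas–Andai: `Vol(D^s_{4,𝕂}(D)) = det(D)^{4d−d²/2} 2^{−6d} ∫_E det(I − Y²)^d χ_d∘σ(√((I−Y)/(I+Y))) dY`).
[cite: LovasAndai2017, Theorem 1] -/
theorem volume_rebitFibrePPTBody_one_eigen :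
    volume (rebitFibrePPTBody (1 : Matrix (Fin 2) (Fin 2) ℝ)) =
      ENNReal.ofReal (4 * π) *
        ∫⁻ m : ℝ, ∫⁻ r in Ioi (0 : ℝ),
          (rebitEigenSet m).indicator (fun r => ENNReal.ofReal (rebitEigenWeight m r) *
            volume (rebitDefectBall (rebitEigenEps m r))) r := by
  rw [volume_rebitFibrePPTBody_one_polar]
  congr 1
  refine lintegral_congr fun m => ?_
  refine lintegral_congr_ae ?_
  filter_upwards [ae_restrict_Ioi_ne_ne m] with r hr
  exact ofReal_mul_volume_rebitPPTSlice_eigen hr.1 hr.2.1 hr.2.2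

/-- **The fibre fact in eigenvalue coordinates (Corollary 2, eq. (psep), set equal to `29/64`)**:
`LovasAndai2017_rebit_fibre_2964 ↔ 64 · ∫∫ r w χ(ε) = 29 · λ₄(𝔹) · ∫∫ r w`, the integrals over
`m ∈ ℝ`, `0 < r < min(m, 1 − m)`, `w = x y (1−x)(1−y)`, `x = m + r`, `y = m − r`,
`χ(ε) = λ₄(rebitDefectBall ε)`, `ε = √(x(1−y))/√(y(1−x))`. What remains of Theorem 2 is the
evaluation of `λ₄(𝔹)` (`= 2π²/3`), of `χ` (Lemma 6) and of the two integrals.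
[cite: LovasAndai2017, Corollary 2 and Theorem 2] -/
theorem LovasAndai2017_rebit_fibre_2964_iff_eigen :
    LovasAndai2017_rebit_fibre_2964 ↔
      64 * ∫⁻ m : ℝ, ∫⁻ r in Ioi (0 : ℝ),
          (rebitEigenSet m).indicator (fun r => ENNReal.ofReal (rebitEigenWeight m r) *
            volume (rebitDefectBall (rebitEigenEps m r))) r =
        29 * (volume rebitOpBall *
          ∫⁻ m : ℝ, ∫⁻ r in Ioi (0 : ℝ),
            (rebitEigenSet m).indicator (fun r => ENNReal.ofReal (rebitEigenWeight m r)) r) := by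
  rw [LovasAndai2017_rebit_fibre_2964_iff_one, volume_rebitFibrePPTBody_one_eigen,
    volume_rebitFibreBody_one_eigen]
  set c := ENNReal.ofReal (4 * π) with hc
  have hc0 : c ≠ 0 := by
    rw [hc]
    have : 0 < 4 * π := by positivity
    simpa only [ne_eq, ENNReal.ofReal_eq_zero, not_le] using this
  have hct : c ≠ ⊤ := ENNReal.ofReal_ne_top
  rw [mul_left_comm 64 c, mul_left_comm 29 c]
  exact ENNReal.mul_right_inj hc0 hct

end Literature.InformationTheory.Entanglement

end
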